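import Mathlib.Data.ZMod.Basic
import Mathlib.Data.Finset.Powerset
import Mathlib.Data.Finset.Card
import Mathlib.Data.Fintype.Sum
import Mathlib.Data.Fintype.Prod
import Mathlib.Data.Fintype.Powerset
import Mathlib.Algebra.BigOperators.Group.Finset.Basic
import HarnessLib

/-!
# The rank-four face of a NON-Galois sextic CM field `K = k·F₀` (normal closure of degree 12): its core
# `B₀ × B₁ × B₂ (× E)` carries Hodge classes outside the span of divisor and quadratic-Weil weights — a kernel census

COR-CM (cell `pub-hodgecm2`), seat b30 gen 13 (2026-08-21); count-neutral companion of the seat's theorems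
`CorCM/CMThreefoldPairWeilClassesOfMarkman.lean` (p249751: the `k`-Weil `(3,3)`-classes of a product of TWO CM threefolds
over one imaginary quadratic field are algebraic modulo Markman's fourfold theorem) and of the census files of seat
André-3 (`Census/CyclicSexticFaces.lean`: for a GALOIS sextic field every face core is the Weil fourfold `B × E`).  A
finite, kernel-decided computation (no named fact, no geometry, no `sorry`); the DICTIONARY to geometry is cited.

MODEL (the statement of the theorems).  `K = k·F₀` with `k` imaginary quadratic and `F₀` a NON-cyclic totally real cubic,
so the normal closure `L` has `Gal(L/ℚ) = S₃ × C₂ = ⟨r, s⟩ × ⟨c⟩` (`r³ = s² = 1`, `s r s = r⁻¹`; `c` = complex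
conjugation, central).  Embeddings `Hom(K, ℚ̄) = {(i, b)}`: `i ∈ ℤ/3` the real place of `F₀` below, `b ∈ {+,−}` the
restriction to `k` (`+` = a fixed `τ : k → ℂ`); `r : i ↦ i+1`, `s : i ↦ -i`, `c : b ↦ -b`.  A CM type of `K` is a sign
vector `ε : ℤ/3 → {±}` (`Φ_ε = {(i, ε i)}`); `Aut(K) = {1, c}` (`ε ↦ -ε`); `ε` is induced from `k` iff constant.  The
rank-four face of `K` in the frame `(0,+),(1,+),(2,+)` — PerL's sign table `perlSign` of `CorCM/CM/Basic.lean`, period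
types `t¹ = (+,+,+)`, `t² = (+,−,−)`, `t³ = (+,−,+)`, `t⁴ = (+,+,−)`, corners `(t¹, t², t̄³, t̄⁴)` — has corners
`(+,+,+)` (INDUCED: `A ~ E³`, `E` the CM curve of `k`) and `(+,−,−), (−,+,−), (−,−,+)` = the three sign vectors with ONE
`+`: primitive, pairwise inequivalent under `Aut(K)`, conjugate under `r` — three pairwise NON-isogenous Galois-conjugate
simple CM threefolds `B₀, B₁, B₂` (`Bₘ` has its `+` at place `m`).  Core `Y = B₀ × B₁ × B₂ × E`: points
`Pt = (slot m, place i, sign b) ⊔ (sign of E)` (`18 + 2 = 20`), CM type `Φ_Y = {(m, i, [m = i])} ⊔ {E+}`.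

DICTIONARY (cited, not formalised).  (i) `Hᵖ'(Y) ⊗ ℚ̄` has the eigenbasis `e_P`, `P ⊂ Pt`, and the space `Bᵖ(Y)` of
Hodge classes in `H^{2p}(Y, ℚ)` has a basis indexed by the `2p`-sets `P` with `|gP ∩ Φ_Y| = p` for all `g ∈ Gal`
[cite: Pohlmann1968, Thm 1] = the tree's `Literature.AlgebraicGeometry.GaoUllmo2025.theorem31` [cite: GaoUllmo2025, Thm 3.1];
unions of conjugate pairs index the products of divisor classes.  (ii) The Hodge (= Mumford–Tate) torus of `Y` is cut out
by the weights of all Hodge sets, so a class built from divisors and `k`-WEIL classes (`⋀_k` of a `k`-fibre: the sets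
`fibre(m, b) ⊔ {E b}` on `Bₘ × E`, `fibre(m, b) ⊔ fibre(m′, -b)` on `Bₘ × Bₘ′`, and their analogues on products of copies)
by pull-back along homomorphisms, cup product and push-forward has all its weights in the `ℚ`-span of those weights
[cite: Deligne1982HodgeCycles, §3 (Mumford–Tate group and Hodge classes) and §5 (c)]; a Hodge set outside that span
indexes a class not so obtainable — in particular not from Markman's theorems on quadratic-Weil fourfolds and sixfolds.

RESULTS (kernel).  `B¹(Y) = 10` (the conjugate pairs); `B²(Y) = 75 = 45 + 30`: THIRTY exceptional codimension-2 sets, of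
which `6` are the `k`-Weil sets of the fourfolds `Bₘ × E` (Markman), `6` are the FACE sets
`X_{i,b} = {(0,i,b), (1,i,b), (2,i,b)} ⊔ {E b}` (one embedding of each threefold over the SAME real place, Künneth type
`(1,1,1,1)`), and `18` lie on the ninefold `B₀ × B₁ × B₂` alone (Künneth type `(2,1,1)`, no `E`); the explicit integer
functionals `λ_{m,i} = e*_{(m,i,+)} - e*_{(m,i,−)} - e*_{(m,i+1,+)} + e*_{(m,i+1,−)}` vanish on EVERY divisor pair, EVERY
`k`-Weil set `fibre ⊔ E` and EVERY `k`-Weil pair set `fibre ⊔ fibre`, and each of the `24` non-`k`-Weil exceptional sets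
is detected by one of them — so NONE of the `24` is in the `ℚ`-span of divisor and quadratic-Weil weights.  Reading
(census, not a theorem about algebraicity): for the closure-12 sextic CM fields the `K`-slice of `HC_CM` has content beyond
Markman's theorems exactly from the ninefold `B₀ × B₁ × B₂` on (codimension `2`); pairs `Bₘ × Bₘ′ (× E)` are
quadratic-Weil generated (`pair_sets_in_span`, and p249751 for the `(3,3)` classes); `Universe.PerL`'s degree clause
`[L:ℚ] ∈ {24, 48}` excludes these `K`, `Universe.PerLFace` (via `L`) covers them.

## References
* [Pohlmann1968] H. Pohlmann, Algebraic cycles on abelian varieties of complex multiplication type, Ann. of Math. 88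
  (1968), Thm 1.  [GaoUllmo2025] Z. Gao, E. Ullmo, J. Inst. Math. Jussieu 25 (2025), Thm 3.1.
* [Deligne1982HodgeCycles] P. Deligne (notes by J. S. Milne), Hodge cycles on abelian varieties, LNM 900 (1982), §3, §5 (c).
* [Markman2025SurveySecant] E. Markman, arXiv:2509.23403, Thm. 1.2 (fourfolds; split sixfolds).

## Provenance
Seat scripts (exact python, < 1 s): session folder `work/scratch/d6_mt.py` (dim MT(B₀) = 4, MT(B₀×B₁) = MT(B₀×B₁×E) =
MT(B₀×B₁×B₂×E) = 6), `work/scratch/d6_pohlmann.py` (the counts below; rank of all Hodge weights `15` = rank of divisor +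
`k`-Weil + face weights, rank of divisor + `k`-Weil weights `13`).
-/

namespace Summit.HodgeConjecture.CorCM.Census.DihedralSexticFace

open Finset

/-! ### The model -/

/-- Points: `(slot m, place i, sign b)` for the three threefolds `B₀, B₁, B₂`, and the sign of the curve `E`.
[cite: GaoUllmo2025, §2.1] -/
abbrev Pt : Type := (Fin 3 × ZMod 3 × Bool) ⊕ Bool

/-- The element `(rʲ sᶠ, cᵈ)` of `S₃ × C₂` (`d = false` means: apply `c`): places `i ↦ ±i + j`, signs flipped by `c`.
[folklore] -/
def act (j : ZMod 3) (f : Bool) (d : Bool) : Pt → Pt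
  | Sum.inl (m, i, b) => Sum.inl (m, (if f then -i else i) + j, if d then b else !b)
  | Sum.inr b => Sum.inr (if d then b else !b)

/-- The CM type of `Y = B₀ × B₁ × B₂ × E`: `Bₘ` has sign `+` exactly at place `m`; `E` has type `{+}`. [folklore] -/
def phi : Finset Pt :=
  {Sum.inl (0, 0, true), Sum.inl (0, 1, false), Sum.inl (0, 2, false),
   Sum.inl (1, 0, false), Sum.inl (1, 1, true), Sum.inl (1, 2, false),
   Sum.inl (2, 0, false), Sum.inl (2, 1, false), Sum.inl (2, 2, true), Sum.inr true}

set_option maxRecDepth 8000 in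
/-- Sanity: `Φ_Y` is a CM type (exactly one of `x`, `c·x`) and `c = act 0 false false`. [folklore] -/
theorem isCMType_phi : ∀ x : Pt, (x ∈ phi ↔ act 0 false false x ∉ phi) := by decide +kernel

set_option maxRecDepth 8000 in
set_option maxHeartbeats 4000000 in
/-- Sanity: the twelve maps `act j f d` are pairwise distinct, `r = act 1 false true` has order `3`, `s = act 0 true true`
and `c` are involutions, `s r s = r⁻¹`, and `c` commutes with `r` and `s` (a faithful `S₃ × C₂`). [folklore] -/
theorem act_relations : (∀ x : Pt, act 1 false true (act 1 false true (act 1 false true x)) = x) ∧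
    (∀ x : Pt, act 0 true true (act 0 true true x) = x) ∧ (∀ x : Pt, act 0 false false (act 0 false false x) = x) ∧
    (∀ x : Pt, act 0 true true (act 1 false true (act 0 true true x)) = act 2 false true x) ∧
    (∀ x : Pt, act 0 false false (act 1 false true x) = act 1 false true (act 0 false false x)) ∧
    (∀ x : Pt, act 0 false false (act 0 true true x) = act 0 true true (act 0 false false x)) ∧
    (∀ g g' : ZMod 3 × Bool × Bool, (∀ x : Pt, act g.1 g.2.1 g.2.2 x = act g'.1 g'.2.1 g'.2.2 x) → g = g') := by
  refine ⟨by decide +kernel, by decide +kernel, by decide +kernel, by decide +kernel, by decide +kernel,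
    by decide +kernel, by decide +kernel⟩

set_option maxRecDepth 8000 in
set_option maxHeartbeats 4000000 in
/-- The corner sign vectors are pairwise `Aut(K)`-inequivalent (`Aut(K) = {1,c}`: `ε`, `-ε`) primitive types, permuted
transitively by `r` — three pairwise non-isogenous, Galois-conjugate simple CM threefolds; stated on the model: `r` maps
slot `m`'s type onto slot `m+1`'s type; slot `m` has `+` at place `m` where the other two slots have `−` (distinct
types), and any two slots share a `−` (not opposite types). [folklore] -/
theorem slots_conjugate_not_isogenous :
    (∀ m : Fin 3, ∀ i : ZMod 3, ∀ b : Bool,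
      ((Sum.inl (m, i, b) : Pt) ∈ phi ↔ (Sum.inl (m + 1, i + 1, b) : Pt) ∈ phi)) ∧
    ({Sum.inl (0, 0, true), Sum.inl (1, 1, true), Sum.inl (2, 2, true)} : Finset Pt) ⊆ phi ∧
    (∀ x ∈ ({Sum.inl (1, 0, true), Sum.inl (2, 0, true), Sum.inl (0, 1, true), Sum.inl (2, 1, true),
        Sum.inl (0, 2, true), Sum.inl (1, 2, true)} : Finset Pt), x ∉ phi) ∧
    ({Sum.inl (0, 2, false), Sum.inl (1, 2, false), Sum.inl (0, 1, false), Sum.inl (2, 1, false),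
        Sum.inl (1, 0, false), Sum.inl (2, 0, false)} : Finset Pt) ⊆ phi := by
  refine ⟨by decide +kernel, by decide +kernel, by decide +kernel, by decide +kernel⟩

/-! ### Pohlmann sets -/

/-- Pohlmann's condition with multiplicity `p`: `#{x ∈ P | g·x ∈ Φ_Y} = p` for all twelve `g`.
[cite: GaoUllmo2025, Thm 3.1 eq. (3.2)] -/
def eq32 (p : ℕ) (P : Finset Pt) : Bool :=
  decide (∀ g : ZMod 3 × Bool × Bool, (P.filter fun x => act g.1 g.2.1 g.2.2 x ∈ phi).card = p)

/-- The Pohlmann `4`-sets of `Y` (a basis of `B²(Y) ⊗ ℚ̄`). [cite: GaoUllmo2025, Thm 3.1] -/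
def hodgeSets : Finset (Finset Pt) := ((univ : Finset Pt).powersetCard 4).filter fun P => eq32 2 P = true

/-- The Pohlmann `2`-sets of `Y` (a basis of `B¹(Y) ⊗ ℚ̄`). [cite: GaoUllmo2025, Thm 3.1] -/
def divisorSets : Finset (Finset Pt) := ((univ : Finset Pt).powersetCard 2).filter fun P => eq32 1 P = true

/-- The ten complex-conjugate pairs `{x, c·x}`. [folklore] -/
def conjPairs : Finset (Finset Pt) := (univ : Finset Pt).image fun x => {x, act 0 false false x}

/-- Exceptional `4`-sets: not `c`-stable (not a product of two divisor classes). [cite: GaoUllmo2025, Thm 3.1] -/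
def exceptional : Finset (Finset Pt) := hodgeSets.filter fun P => ∃ x ∈ P, act 0 false false x ∉ P

/-- The `k`-Weil sets of the fourfolds `Bₘ × E`: a full `k`-fibre of slot `m` and the point of `E` of the same sign
(`⋀⁴_k H¹(Bₘ × E)`, Hodge type `(1,2) + (1,0) = (2,2)`). [cite: Deligne1982HodgeCycles, §5 (c)] -/
def kWeilSets : Finset (Finset Pt) :=
  (univ : Finset (Fin 3 × Bool)).image fun mb =>
    {Sum.inl (mb.1, 0, mb.2), Sum.inl (mb.1, 1, mb.2), Sum.inl (mb.1, 2, mb.2), Sum.inr mb.2}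

/-- The `k`-Weil pair sets of the sixfolds `Bₘ × Bₘ′` (`m ≠ m′`): `fibre(m, b) ⊔ fibre(m′, -b)` (`⋀⁶_k`, type `(3,3)`) —
the classes made algebraic modulo Markman by `CorCM/CMThreefoldPairWeilClassesOfMarkman.lean`.
[cite: Deligne1982HodgeCycles, §5 (c)] -/
def pairWeilSets : Finset (Finset Pt) :=
  ((univ : Finset (Fin 3 × Fin 3 × Bool)).filter fun t => t.1 ≠ t.2.1).image fun t =>
    {Sum.inl (t.1, 0, t.2.2), Sum.inl (t.1, 1, t.2.2), Sum.inl (t.1, 2, t.2.2),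
     Sum.inl (t.2.1, 0, !t.2.2), Sum.inl (t.2.1, 1, !t.2.2), Sum.inl (t.2.1, 2, !t.2.2)}

/-- The FACE sets `X_{i,b}`: one embedding of each threefold over the same real place `i`, same sign `b`, and the point
of `E` of sign `b` — the weights of the `K`-Weil line of the rank-four face (Künneth type `(1,1,1,1)`). [folklore] -/
def faceSets : Finset (Finset Pt) :=
  (univ : Finset (ZMod 3 × Bool)).image fun ib =>
    {Sum.inl (0, ib.1, ib.2), Sum.inl (1, ib.1, ib.2), Sum.inl (2, ib.1, ib.2), Sum.inr ib.2}

set_option maxRecDepth 8000 in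
set_option maxHeartbeats 4000000 in
/-- **Degree one**: the Pohlmann `2`-sets are the ten conjugate pairs (`B¹(Y) = 10 = 3·3 + 1`; no mixed divisor
classes: the four factors are pairwise non-isogenous). [cite: GaoUllmo2025, Thm 3.1] -/
theorem divisorSets_eq : divisorSets = conjPairs ∧ conjPairs.card = 10 := by decide +kernel

set_option maxRecDepth 8000 in
set_option maxHeartbeats 4000000 in
/-- **The census in codimension two**: `B²(Y) = 75`, of which `45` are unions of two conjugate pairs and `30` are
exceptional. [cite: GaoUllmo2025, Thm 3.1] -/
theorem card_hodgeSets : hodgeSets.card = 75 ∧ exceptional.card = 30 ∧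
    (hodgeSets.filter fun P => ∀ x ∈ P, act 0 false false x ∈ P).card = 45 := by
  refine ⟨by decide +kernel, by decide +kernel, by decide +kernel⟩

set_option maxRecDepth 8000 in
set_option maxHeartbeats 4000000 in
/-- **Structure of the thirty exceptional sets**: the six `k`-Weil sets of the fourfolds `Bₘ × E` and the six face sets
are exceptional Hodge sets; the exceptional sets containing a point of `E` are exactly these twelve; the remaining `18`
lie on the ninefold `B₀ × B₁ × B₂` and have Künneth type `(2,1,1)` (two embeddings of one threefold, one of each other).
[cite: GaoUllmo2025, Thm 3.1] -/
theorem exceptional_structure : kWeilSets ⊆ exceptional ∧ faceSets ⊆ exceptional ∧ kWeilSets.card = 6 ∧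
    faceSets.card = 6 ∧ Disjoint kWeilSets faceSets ∧
    (exceptional.filter fun P => ∃ b : Bool, Sum.inr b ∈ P) = kWeilSets ∪ faceSets ∧
    (exceptional.filter fun P => ∀ b : Bool, Sum.inr b ∉ P).card = 18 ∧
    (∀ P ∈ exceptional, (∀ b : Bool, Sum.inr b ∉ P) →
      ∃ m : Fin 3, (P.filter fun x => ∃ i : ZMod 3, ∃ b : Bool, x = Sum.inl (m, i, b)).card = 2 ∧
        ∀ m' : Fin 3, m' ≠ m → (P.filter fun x => ∃ i : ZMod 3, ∃ b : Bool, x = Sum.inl (m', i, b)).card = 1) := by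
  refine ⟨by decide +kernel, by decide +kernel, by decide +kernel, by decide +kernel, by decide +kernel,
    by decide +kernel, by decide +kernel, by decide +kernel⟩

/-! ### The span certificate -/

/-- The integer functional `λ_{m,i} = e*_{(m,i,+)} - e*_{(m,i,−)} - e*_{(m,i+1,+)} + e*_{(m,i+1,−)}`. [folklore] -/
def lam (m : Fin 3) (i : ZMod 3) : Pt → ℤ
  | Sum.inl (m', i', b) =>
    if m' = m ∧ i' = i then (if b then 1 else -1) else if m' = m ∧ i' = i + 1 then (if b then -1 else 1) else 0
  | Sum.inr _ => 0

/-- Pairing of a functional with (the weight of) a set. [folklore] -/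
def pairing (l : Pt → ℤ) (P : Finset Pt) : ℤ := ∑ x ∈ P, l x

/-- The weight (indicator function) of a set of points. [folklore] -/
def wt (P : Finset Pt) : Pt → ℤ := fun x => if x ∈ P then 1 else 0

set_option maxRecDepth 8000 in
set_option maxHeartbeats 4000000 in
/-- **The pair sets ARE quadratic-Weil generated** (weight level): every `k`-Weil pair set of `Bₘ × Bₘ′` is a Hodge
`6`-set of `Y` (Pohlmann multiplicity `3`), and its weight is `wt(kWeil(m,b)) + wt(kWeil(m′,-b)) − wt{E+, E−}`
(two fourfold Weil weights minus a divisor weight) — the weight form of the tree theorem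
`CMThreefoldPair.weilClassesOf_prod_le_algebraicClasses_of_markman` (p249751). [cite: Deligne1982HodgeCycles, §5 (c)] -/
theorem pair_sets_in_span :
    (∀ P ∈ pairWeilSets, ∀ g : ZMod 3 × Bool × Bool, (P.filter fun x => act g.1 g.2.1 g.2.2 x ∈ phi).card = 3) ∧
    pairWeilSets.card = 6 ∧
    (∀ t : Fin 3 × Fin 3 × Bool, t.1 ≠ t.2.1 →
      wt {Sum.inl (t.1, 0, t.2.2), Sum.inl (t.1, 1, t.2.2), Sum.inl (t.1, 2, t.2.2),
          Sum.inl (t.2.1, 0, !t.2.2), Sum.inl (t.2.1, 1, !t.2.2), Sum.inl (t.2.1, 2, !t.2.2)} =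
        wt {Sum.inl (t.1, 0, t.2.2), Sum.inl (t.1, 1, t.2.2), Sum.inl (t.1, 2, t.2.2), Sum.inr t.2.2} +
          wt {Sum.inl (t.2.1, 0, !t.2.2), Sum.inl (t.2.1, 1, !t.2.2), Sum.inl (t.2.1, 2, !t.2.2), Sum.inr (!t.2.2)} -
          wt {Sum.inr true, Sum.inr false}) := by
  refine ⟨by decide +kernel, by decide +kernel, by decide +kernel⟩

set_option maxRecDepth 8000 in
set_option maxHeartbeats 4000000 in
/-- **The span certificate.**  Every functional `λ_{m,i}` vanishes on every conjugate pair (divisor weights), on every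
`k`-Weil set of `Bₘ′ × E` and on every `k`-Weil pair set of `Bₘ′ × Bₘ″` — hence on the `ℚ`-span of all divisor and
quadratic-Weil weights of `Y` — while each of the `24` exceptional sets that is not a `k`-Weil set (the `6` face sets and
the `18` ninefold sets) is detected (`λ_{m,i} ≠ 0` on it) by some `λ_{m,i}`.  So NONE of these `24` Hodge sets has its
weight in the `ℚ`-span of divisor and quadratic-Weil weights. [cite: Deligne1982HodgeCycles, §3 and §5 (c)]
[cite: GaoUllmo2025, Thm 3.1] -/
theorem span_certificate :
    (∀ m : Fin 3, ∀ i : ZMod 3, ∀ Q ∈ conjPairs, pairing (lam m i) Q = 0) ∧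
    (∀ m : Fin 3, ∀ i : ZMod 3, ∀ Q ∈ kWeilSets, pairing (lam m i) Q = 0) ∧
    (∀ m : Fin 3, ∀ i : ZMod 3, ∀ Q ∈ pairWeilSets, pairing (lam m i) Q = 0) ∧
    (∀ P ∈ exceptional, P ∉ kWeilSets → ∃ mi : Fin 3 × ZMod 3, pairing (lam mi.1 mi.2) P ≠ 0) ∧
    (exceptional.filter fun P => P ∉ kWeilSets).card = 24 := by
  refine ⟨by decide +kernel, by decide +kernel, by decide +kernel, by decide +kernel, by decide +kernel⟩

end Summit.HodgeConjecture.CorCM.Census.DihedralSexticFace
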